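import Mathlib
import HarnessLib
import Summits.HubbardSuperconductivity.HubbardSuperconductivity.Theorems.KLProgrammeKLRegimeEngineV8E5BlockLabels

/-!
# Route `KLProgramme` — ENGINE child gen 8 (stmt-HubbardSuperconductivity-20437 `KLRegimeEngineV17F2`), SKELETON v2 class #3, (RA-U) SUPPLIER part 4,
# input 3: the OVERLAP ROWS `(cr⁺, cc⁺)` of the POINT-AUGMENTED pair `E(F′⁺)·S(F̃⁺)` from the plain rows `(cr, cc)` of `E(F′)·S(F̃)`
# (cell gate-hubbard-kl, seat p5 g14; memo HOME/prover-p5/g11/RA-U-SUPPLY-g11.md §7.3 item 3; companion of `…E5PointAugment` (p5 g7))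

WHY.  The three one-step doors of the carrier split (`carrier_smearTotal_firstOrder_le`, `carrier_increment_ordersGe2_le`, `carrier_smearSoft_firstOrder_le`,
…E5CarrierDoors) read the Young constants `hrow′ : ∀ X″, Σ_{X′} ‖(E(F′⁺)·S(F̃⁺)) X″ X′‖ ≤ cr` and `hcol′ : ∀ X′, Σ_{X″} ‖…‖ ≤ cc` of the overlap matrix of the
OUTPUT thin family `F′⁺ = pointAugment F′ e` against the INPUT fat family `F̃⁺ = pointAugmentFat F F̃ e` (`e = klE5ExtMomenta Qm x y`, four point legs).  The plain
rows of `E(klAnisoFamily J′)·S(bgmFatMultiplier j)` are the (L2) overlap data of the tower (p3/p4: `overlapWt_towerBlock_klEng_flow_deep`, `overlapWt_colSum_klEng_flow_deep`,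
weight `klScaleWt ≥ 1`); this module is the TRANSFER to the augmented pair — pure bookkeeping on the four blocks of `E(F′⁺)·S(F̃⁺)`:

* §1 generic tools for `E(G′)·S(G)` (`sectorAnalysis_mul_sectorSub_apply`): the momentum-space entry bound `‖(E·S) Y″ Y′‖ ≤ (βL²)⁻¹ Σ_k ‖G′_{ω″}(k)‖‖G_{ω′}(k)‖`,
  vanishing off the spin/charge diagonal, the FACTORISATION through the single momentum of a leg supported at one point (`…_of_single_left/_right`), the column sums
  of `E(G′)` alone (`sum_norm_sectorAnalysisMatrix_eq`: `= |SpaceTimeIdx|·Σ_ω ‖G′_ω(k)‖`), and the split of a sum over `SpaceTimeIdx × SectorLeg (N + q)` into old legs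
  (`augLeg`) and point legs;
* §2 the four blocks: old × old `=` the plain entry (`overlap_pointAugment_augLeg_augLeg`); old-thin × point-fat `≤ (βL²)⁻¹‖F′_{ω″}(e_{j′})‖` and `= 0` when `F′`
  lives in the plateau of `F` (the nesting `J′ ≥ j + 1` of the model); point-thin × any: the row FACTORS through `ψ̂_{e_j}` (norm of the thin factor `≤ 1`);
* §3 **`rowSum_overlap_pointAugment_le`**: `Σ_{X′} ‖(E(F′⁺)S(F̃⁺)) X″ X′‖ ≤ cr + (ρ₁ + q)·ε⁻¹` and **`colSum_overlap_pointAugment_le`**: `Σ_{X″} ‖…‖ ≤ cc + (ρ′ + q)·ε⁻¹`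
  (`ε⁻¹ := ‖(βL²)⁻¹‖·|SpaceTimeIdx|`, `= (imagTimeWeight β M)⁻¹` in the companion `…E5PointAugmentOverlapModel`), from: the plain rows/cols `(cr, cc)`, `‖F′‖ ≤ 1`, `‖1 − Σ_ω F′_ω‖ ≤ 1`,
  `Σ_ω ‖F′_ω(k)‖ ≤ ρ′` (thin multiplicity), `‖F̃‖ ≤ 1`, `#{ω′ : F̃_{ω′}(k) ≠ 0} ≤ ρ₁` (fat multiplicity);

Everything is proved; no definitions besides the abbreviation-free statements; no named facts; nothing about the model's sizes is asserted; nothing asserts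
superconductivity. [cite: BenfattoGiulianiMastropietro2006, §2.7 (2.71)–(2.71a)]
-/

noncomputable section

namespace Summit.HubbardSuperconductivity.HubbardSuperconductivity.Theorems.KLRegimeSplit

set_option linter.dupNamespace false -- summit = problem name (single-conjunct summit), D-0017

open Real Finset Literature.MathematicalPhysics.QuantumLattice Literature.Probability.LatticeModels Matrix
open Summit.HubbardSuperconductivity.HubbardSuperconductivity.Theorems.KLProgrammeLegKernels
open Summit.HubbardSuperconductivity.HubbardSuperconductivity.Theorems.KLRegimeWick
open Summit.HubbardSuperconductivity.HubbardSuperconductivity.Theorems.TorusFourierL2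

/-! ## §1 Generic tools for the overlap matrix `E(G′)·S(G)` -/

section Tools

variable {L M N N' : ℕ} [NeZero L] (β : ℝ)

/-- **Momentum-space bound of an overlap entry**: `‖(E(G′)·S(G)) Y″ Y′‖ ≤ ‖(βL²)⁻¹‖·Σ_k ‖G′_{ω″}(k)‖·‖G_{ω′}(k)‖` (plane waves are unimodular).
[cite: BenfattoGiulianiMastropietro2006, §2.7 (2.71)] -/
theorem norm_sectorAnalysis_mul_sectorSub_le (G' : Fin N' → FreqMomentum L M → ℂ) (G : Fin N → FreqMomentum L M → ℂ)
    (Y'' : SpaceTimeIdx L M × SectorLeg N') (Y' : SpaceTimeIdx L M × SectorLeg N) :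
    ‖(sectorAnalysisMatrix L M β G' * sectorSubMatrix L M β G) Y'' Y'‖ ≤
      ‖((1 / (β * (L : ℝ) ^ 2) : ℝ) : ℂ)‖ * ∑ k : FreqMomentum L M, ‖G' Y''.2.1.1 k‖ * ‖G Y'.2.1.1 k‖ := by
  rw [sectorAnalysis_mul_sectorSub_apply]
  split_ifs with h
  · refine (norm_sum_le _ _).trans (le_of_eq ?_)
    rw [mul_sum]
    refine sum_congr rfl fun k _ => ?_
    rw [norm_mul, norm_mul, norm_mul, norm_mul, norm_hubbardPlaneWave, Complex.norm_conj, norm_hubbardPlaneWave]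
    ring
  · rw [norm_zero]
    exact mul_nonneg (norm_nonneg _) (sum_nonneg fun k _ => mul_nonneg (norm_nonneg _) (norm_nonneg _))

/-- Overlap entries vanish off the spin/charge diagonal. [cite: BenfattoGiulianiMastropietro2006, §2.7 (2.71)] -/
theorem sectorAnalysis_mul_sectorSub_apply_of_not (G' : Fin N' → FreqMomentum L M → ℂ) (G : Fin N → FreqMomentum L M → ℂ)
    (Y'' : SpaceTimeIdx L M × SectorLeg N') (Y' : SpaceTimeIdx L M × SectorLeg N) (h : ¬(Y'.2.1.2 = Y''.2.1.2 ∧ Y'.2.2 = Y''.2.2)) :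
    (sectorAnalysisMatrix L M β G' * sectorSubMatrix L M β G) Y'' Y' = 0 := by
  rw [sectorAnalysis_mul_sectorSub_apply, if_neg h]

/-- **Factorisation through a point ROW leg**: if the thin multiplier `G′_{ω₀}` is supported at the single momentum `k₀`, then
`(E(G′)·S(G)) (x″,(ω₀,σ,c)) Y′ = E(G′) (x″,(ω₀,σ,c)) (k₀,σ,c) · S(G) (k₀,σ,c) Y′`. [cite: BenfattoGiulianiMastropietro2006, §2.7 (2.71)] -/
theorem sectorAnalysis_mul_sectorSub_apply_of_single_left (G' : Fin N' → FreqMomentum L M → ℂ) (G : Fin N → FreqMomentum L M → ℂ)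
    {ω₀ : Fin N'} {k₀ : FreqMomentum L M} (hω₀ : ∀ k, k ≠ k₀ → G' ω₀ k = 0) (x'' : SpaceTimeIdx L M) (σ c : Fin 2)
    (Y' : SpaceTimeIdx L M × SectorLeg N) :
    (sectorAnalysisMatrix L M β G' * sectorSubMatrix L M β G) (x'', ((ω₀, σ), c)) Y' =
      sectorAnalysisMatrix L M β G' (x'', ((ω₀, σ), c)) ((k₀, σ), c) * sectorSubMatrix L M β G ((k₀, σ), c) Y' := by
  rw [Matrix.mul_apply]
  refine Fintype.sum_eq_single ((k₀, σ), c) fun K hK => ?_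
  simp only [sectorAnalysisMatrix_apply]
  by_cases hm : K.1.2 = σ ∧ K.2 = c
  · have hk : K.1.1 ≠ k₀ := fun hk => hK (Prod.ext (Prod.ext hk hm.1) hm.2)
    rw [if_pos hm, hω₀ _ hk, zero_mul, zero_mul]
  · rw [if_neg hm, zero_mul]

/-- **Factorisation through a point COLUMN leg**: if the fat multiplier `G_{ω₀}` is supported at the single momentum `k₀`, then
`(E(G′)·S(G)) Y″ (x′,(ω₀,σ,c)) = E(G′) Y″ (k₀,σ,c) · S(G) (k₀,σ,c) (x′,(ω₀,σ,c))`. [cite: BenfattoGiulianiMastropietro2006, §2.7 (2.71)] -/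
theorem sectorAnalysis_mul_sectorSub_apply_of_single_right (G' : Fin N' → FreqMomentum L M → ℂ) (G : Fin N → FreqMomentum L M → ℂ)
    {ω₀ : Fin N} {k₀ : FreqMomentum L M} (hω₀ : ∀ k, k ≠ k₀ → G ω₀ k = 0) (Y'' : SpaceTimeIdx L M × SectorLeg N')
    (x' : SpaceTimeIdx L M) (σ c : Fin 2) :
    (sectorAnalysisMatrix L M β G' * sectorSubMatrix L M β G) Y'' (x', ((ω₀, σ), c)) =
      sectorAnalysisMatrix L M β G' Y'' ((k₀, σ), c) * sectorSubMatrix L M β G ((k₀, σ), c) (x', ((ω₀, σ), c)) := by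
  rw [Matrix.mul_apply]
  refine Fintype.sum_eq_single ((k₀, σ), c) fun K hK => ?_
  simp only [sectorSubMatrix_apply]
  by_cases hm : K.1.2 = σ ∧ K.2 = c
  · have hk : K.1.1 ≠ k₀ := fun hk => hK (Prod.ext (Prod.ext hk hm.1) hm.2)
    rw [if_pos hm, hω₀ _ hk, zero_mul, mul_zero, mul_zero]
  · rw [if_neg hm, mul_zero]

omit [NeZero L] in
/-- The norm of a diagonal entry of `E(G′)`: `‖E(G′) (x,(ω,σ,c)) (k,σ,c)‖ = ‖G′_ω(k)‖`. [folklore] -/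
theorem norm_sectorAnalysisMatrix_apply_diag (G' : Fin N' → FreqMomentum L M → ℂ) (x : SpaceTimeIdx L M) (ω : Fin N') (σ c : Fin 2)
    (k : FreqMomentum L M) : ‖sectorAnalysisMatrix L M β G' (x, ((ω, σ), c)) ((k, σ), c)‖ = ‖G' ω k‖ := by
  rw [sectorAnalysisMatrix_apply, if_pos ⟨rfl, rfl⟩, norm_mul, norm_hubbardPlaneWave, mul_one]

omit [NeZero L] in
/-- The norm of any entry of `E(G′)` is at most `‖G′_ω(k)‖`. [folklore] -/
theorem norm_sectorAnalysisMatrix_apply_le (G' : Fin N' → FreqMomentum L M → ℂ) (Y : SpaceTimeIdx L M × SectorLeg N') (K : HubbardFieldIdx L M) :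
    ‖sectorAnalysisMatrix L M β G' Y K‖ ≤ ‖G' Y.2.1.1 K.1.1‖ := by
  rw [sectorAnalysisMatrix_apply]
  split_ifs
  · rw [norm_mul, norm_hubbardPlaneWave, mul_one]
  · rw [norm_zero]; exact norm_nonneg _

omit [NeZero L] in
/-- The norm of any entry of `S(G)` is at most `‖(βL²)⁻¹‖·‖G_ω(k)‖`. [folklore] -/
theorem norm_sectorSubMatrix_apply_le_mul (G : Fin N → FreqMomentum L M → ℂ) (K : HubbardFieldIdx L M) (Y : SpaceTimeIdx L M × SectorLeg N) :
    ‖sectorSubMatrix L M β G K Y‖ ≤ ‖((1 / (β * (L : ℝ) ^ 2) : ℝ) : ℂ)‖ * ‖G Y.2.1.1 K.1.1‖ := by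
  rw [sectorSubMatrix_apply]
  split_ifs
  · rw [norm_mul, norm_mul, Complex.norm_conj, norm_hubbardPlaneWave, mul_one]
  · rw [norm_zero]; positivity

/-- **Column sums of the analysis matrix**: `Σ_{Y″} ‖E(G′) Y″ K‖ = |SpaceTimeIdx|·Σ_ω ‖G′_ω(k)‖` (spin and charge of the leg are those of `K`).
[cite: BenfattoGiulianiMastropietro2006, §2.7 (2.70)] -/
theorem sum_norm_sectorAnalysisMatrix_eq (G' : Fin N' → FreqMomentum L M → ℂ) (K : HubbardFieldIdx L M) :
    ∑ Y'' : SpaceTimeIdx L M × SectorLeg N', ‖sectorAnalysisMatrix L M β G' Y'' K‖ =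
      (Fintype.card (SpaceTimeIdx L M) : ℝ) * ∑ ω : Fin N', ‖G' ω K.1.1‖ := by
  rw [Fintype.sum_prod_type]
  have hx : ∀ x : SpaceTimeIdx L M, ∑ Y2 : SectorLeg N', ‖sectorAnalysisMatrix L M β G' (x, Y2) K‖ = ∑ ω : Fin N', ‖G' ω K.1.1‖ := by
    intro x
    rw [Fintype.sum_prod_type, Fintype.sum_prod_type]
    refine sum_congr rfl fun ω _ => ?_
    rw [Fintype.sum_eq_single K.1.2 fun σ hσ => ?_, Fintype.sum_eq_single K.2 fun c hc => ?_]
    · rw [sectorAnalysisMatrix_apply, if_pos ⟨rfl, rfl⟩, norm_mul, norm_hubbardPlaneWave, mul_one]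
    · rw [sectorAnalysisMatrix_apply, if_neg (fun h => hc h.2.symm), norm_zero]
    · exact sum_eq_zero fun c _ => by rw [sectorAnalysisMatrix_apply, if_neg (fun h => hσ h.1.symm), norm_zero]
  simp_rw [hx]
  rw [sum_const, card_univ, nsmul_eq_mul]

/-- A double sum over spin and charge of a function vanishing off one point is its value there. [folklore] -/
theorem sum_spin_charge_eq_single (g : Fin 2 → Fin 2 → ℝ) (σ₀ c₀ : Fin 2) (hg : ∀ σ c, ¬(σ = σ₀ ∧ c = c₀) → g σ c = 0) :
    ∑ σ, ∑ c, g σ c = g σ₀ c₀ := by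
  rw [Fintype.sum_eq_single σ₀ fun σ hσ => Fintype.sum_eq_zero _ fun c => hg σ c fun h => hσ h.1,
    Fintype.sum_eq_single c₀ fun c hc => hg σ₀ c fun h => hc h.2]

variable {q : ℕ}

/-- **Old legs and point legs**: a sum over `SpaceTimeIdx × SectorLeg (N + q)` is the sum over the old legs `augLeg Y` plus the sum over the point legs
`(x, ((Fin.natAdd N j, σ), c))`. [folklore] -/
theorem sum_sectorLegAug_split (f : SpaceTimeIdx L M × SectorLeg (N + q) → ℝ) :
    ∑ Y, f Y = (∑ Y : SpaceTimeIdx L M × SectorLeg N, f (augLeg Y)) +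
      ∑ x : SpaceTimeIdx L M, ∑ j : Fin q, ∑ σ : Fin 2, ∑ c : Fin 2, f (x, ((Fin.natAdd N j, σ), c)) := by
  have h1 : ∑ Y, f Y = ∑ x : SpaceTimeIdx L M, ∑ ω : Fin (N + q), ∑ σ : Fin 2, ∑ c : Fin 2, f (x, ((ω, σ), c)) := by
    rw [Fintype.sum_prod_type]
    refine sum_congr rfl fun x _ => ?_
    rw [Fintype.sum_prod_type, Fintype.sum_prod_type]
  have h2 : ∑ Y : SpaceTimeIdx L M × SectorLeg N, f (augLeg Y) =
      ∑ x : SpaceTimeIdx L M, ∑ ω : Fin N, ∑ σ : Fin 2, ∑ c : Fin 2, f (x, ((Fin.castAdd q ω, σ), c)) := by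
    rw [Fintype.sum_prod_type]
    refine sum_congr rfl fun x _ => ?_
    rw [Fintype.sum_prod_type, Fintype.sum_prod_type]
    rfl
  rw [h1, h2, ← sum_add_distrib]
  refine sum_congr rfl fun x _ => ?_
  rw [Fin.sum_univ_add]

end Tools

/-! ## §2 The four blocks of `E(pointAugment F′ e)·S(pointAugmentFat F F̃ e)` -/

section Blocks

variable {L M N N' q : ℕ} [NeZero L] (β : ℝ) (F' : Fin N' → FreqMomentum L M → ℂ) (F Ft : Fin N → FreqMomentum L M → ℂ)
  (e : Fin q → FreqMomentum L M)

omit [NeZero L] in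
/-- A thin point multiplier is supported at its momentum. -/
theorem pointAugment_natAdd_eq_zero_of_ne (j : Fin q) (k : FreqMomentum L M) (hk : k ≠ e j) : pointAugment F' e (Fin.natAdd N' j) k = 0 := by
  rw [pointAugment_natAdd, if_neg (fun h => hk h.symm)]

omit [NeZero L] in
/-- A fat point indicator is supported at its momentum. -/
theorem pointAugmentFat_natAdd_eq_zero_of_ne (j : Fin q) (k : FreqMomentum L M) (hk : k ≠ e j) : pointAugmentFat F Ft e (Fin.natAdd N j) k = 0 := by
  rw [pointAugmentFat_natAdd, if_neg (fun h => hk h.1.symm)]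

omit [NeZero L] in
/-- A fat point indicator has norm `≤ 1`. -/
theorem norm_pointAugmentFat_natAdd_le_one (j : Fin q) (k : FreqMomentum L M) : ‖pointAugmentFat F Ft e (Fin.natAdd N j) k‖ ≤ 1 := by
  rw [pointAugmentFat_natAdd]
  split_ifs <;> simp

/-- **Old × old block**: on old legs the augmented overlap matrix IS the plain one. [cite: BenfattoGiulianiMastropietro2006, §2.7 (2.71)] -/
theorem overlap_pointAugment_augLeg_augLeg (Y'' : SpaceTimeIdx L M × SectorLeg N') (Y' : SpaceTimeIdx L M × SectorLeg N) :
    (sectorAnalysisMatrix L M β (pointAugment F' e) * sectorSubMatrix L M β (pointAugmentFat F Ft e)) (augLeg Y'') (augLeg Y') =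
      (sectorAnalysisMatrix L M β F' * sectorSubMatrix L M β Ft) Y'' Y' := by
  simp only [sectorAnalysis_mul_sectorSub_apply, augLeg, pointAugment_castAdd, pointAugmentFat_castAdd]

/-- **Old-thin × point-fat block**: `‖(E(F′⁺)S(F̃⁺)) (augLeg Y″) (x′,(point j′,σ,c))‖ ≤ ‖(βL²)⁻¹‖·‖F′_{ω″}(e_{j′})‖`.
[cite: BenfattoGiulianiMastropietro2006, §2.7 (2.71)] -/
theorem norm_overlap_pointAugment_augLeg_natAdd_le (Y'' : SpaceTimeIdx L M × SectorLeg N') (x' : SpaceTimeIdx L M) (j' : Fin q) (σ c : Fin 2) :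
    ‖(sectorAnalysisMatrix L M β (pointAugment F' e) * sectorSubMatrix L M β (pointAugmentFat F Ft e)) (augLeg Y'') (x', ((Fin.natAdd N j', σ), c))‖ ≤
      ‖((1 / (β * (L : ℝ) ^ 2) : ℝ) : ℂ)‖ * ‖F' Y''.2.1.1 (e j')‖ := by
  rw [sectorAnalysis_mul_sectorSub_apply_of_single_right β _ _ (pointAugmentFat_natAdd_eq_zero_of_ne F Ft e j') (augLeg Y'') x' σ c, norm_mul]
  have h1 : ‖sectorAnalysisMatrix L M β (pointAugment F' e) (augLeg Y'') ((e j', σ), c)‖ ≤ ‖F' Y''.2.1.1 (e j')‖ := by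
    refine (norm_sectorAnalysisMatrix_apply_le β _ _ _).trans (le_of_eq ?_)
    simp only [augLeg, pointAugment_castAdd]
  have h2 : ‖sectorSubMatrix L M β (pointAugmentFat F Ft e) ((e j', σ), c) (x', ((Fin.natAdd N j', σ), c))‖ ≤ ‖((1 / (β * (L : ℝ) ^ 2) : ℝ) : ℂ)‖ :=
    (norm_sectorSubMatrix_apply_le_mul β _ _ _).trans (mul_le_of_le_one_right (norm_nonneg _) (norm_pointAugmentFat_natAdd_le_one F Ft e j' _))
  calc _ ≤ ‖F' Y''.2.1.1 (e j')‖ * ‖((1 / (β * (L : ℝ) ^ 2) : ℝ) : ℂ)‖ := mul_le_mul h1 h2 (norm_nonneg _) (norm_nonneg _)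
    _ = _ := mul_comm _ _

/-- **Old-thin × point-fat block VANISHES under nesting**: if `F′` lives in the plateau of `F` (`F′_{ω″}(k) ≠ 0 ⇒ Σ_ω F_ω(k) = 1`; the model's
`J′ ≥ j + 1`, `sum_klAnisoFamily_eq_one_of_klAnisoFamily_ne_zero`), the fat point indicators never meet an old thin leg. [cite: BenfattoGiulianiMastropietro2006, §2.7 (2.71)] -/
theorem overlap_pointAugment_augLeg_natAdd_eq_zero (hpl : ∀ ω k, F' ω k ≠ 0 → ∑ ω₀, F ω₀ k = 1) (Y'' : SpaceTimeIdx L M × SectorLeg N')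
    (x' : SpaceTimeIdx L M) (j' : Fin q) (σ c : Fin 2) :
    (sectorAnalysisMatrix L M β (pointAugment F' e) * sectorSubMatrix L M β (pointAugmentFat F Ft e)) (augLeg Y'') (x', ((Fin.natAdd N j', σ), c)) = 0 := by
  rw [sectorAnalysis_mul_sectorSub_apply_of_single_right β _ _ (pointAugmentFat_natAdd_eq_zero_of_ne F Ft e j') (augLeg Y'') x' σ c]
  by_cases h0 : F' Y''.2.1.1 (e j') = 0
  · rw [sectorAnalysisMatrix_apply]
    simp only [augLeg, pointAugment_castAdd, h0, zero_mul, ite_self]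
  · rw [sectorSubMatrix_apply]
    split_ifs
    · rw [pointAugmentFat_natAdd, if_neg (fun h => h.2 (hpl _ _ h0)), zero_mul, mul_zero, mul_zero]
    · rw [mul_zero]

/-- **Point-thin ROW: the row sum factors through `ψ̂_{e_j}`** — `Σ_{X′} ‖(E(F′⁺)S(F̃⁺)) (x″,(point j,σ,c)) X′‖ ≤ (ρ₁ + q)·‖(βL²)⁻¹‖·|SpaceTimeIdx|`
(`‖P_j‖ ≤ 1` from `‖F′‖ ≤ 1`, `‖1 − ΣF′‖ ≤ 1`; the augmented fat multiplicity `ρ₁ + q`). [cite: BenfattoGiulianiMastropietro2006, §2.7 (2.71a)] -/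
theorem rowSum_overlap_pointAugment_natAdd_le (hF' : ∀ ω k, ‖F' ω k‖ ≤ 1) (hR : ∀ k, ‖1 - ∑ ω, F' ω k‖ ≤ 1) (hFt : ∀ ω k, ‖Ft ω k‖ ≤ 1)
    {ρ₁ : ℕ} (hρ₁ : ∀ k : FreqMomentum L M, ((univ : Finset (Fin N)).filter fun ω => Ft ω k ≠ 0).card ≤ ρ₁)
    (x'' : SpaceTimeIdx L M) (j : Fin q) (σ c : Fin 2) :
    ∑ X' : SpaceTimeIdx L M × SectorLeg (N + q),
        ‖(sectorAnalysisMatrix L M β (pointAugment F' e) * sectorSubMatrix L M β (pointAugmentFat F Ft e)) (x'', ((Fin.natAdd N' j, σ), c)) X'‖ ≤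
      ((ρ₁ + q : ℕ) : ℝ) * (‖((1 / (β * (L : ℝ) ^ 2) : ℝ) : ℂ)‖ * Fintype.card (SpaceTimeIdx L M)) := by
  have hfac : ∀ X' : SpaceTimeIdx L M × SectorLeg (N + q),
      ‖(sectorAnalysisMatrix L M β (pointAugment F' e) * sectorSubMatrix L M β (pointAugmentFat F Ft e)) (x'', ((Fin.natAdd N' j, σ), c)) X'‖ ≤
        ‖sectorSubMatrix L M β (pointAugmentFat F Ft e) ((e j, σ), c) X'‖ := by
    intro X'
    rw [sectorAnalysis_mul_sectorSub_apply_of_single_left β _ _ (pointAugment_natAdd_eq_zero_of_ne F' e j) x'' σ c X', norm_mul]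
    refine mul_le_of_le_one_left (norm_nonneg _) ?_
    rw [norm_sectorAnalysisMatrix_apply_diag]
    exact norm_pointAugment_le_one F' e hF' hR _ _
  refine (sum_le_sum fun X' _ => hfac X').trans ?_
  calc ∑ X' : SpaceTimeIdx L M × SectorLeg (N + q), ‖sectorSubMatrix L M β (pointAugmentFat F Ft e) ((e j, σ), c) X'‖
      ≤ (‖((1 / (β * (L : ℝ) ^ 2) : ℝ) : ℂ)‖ * Fintype.card (SpaceTimeIdx L M)) * ((ρ₁ + q : ℕ) : ℝ) :=
        sum_norm_sectorSubMatrix_le β _ (norm_pointAugmentFat_le_one F Ft e hFt) (card_filter_pointAugmentFat_ne_zero_le F Ft e hρ₁) _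
    _ = _ := mul_comm _ _

/-- **Point-fat COLUMN: the column sum factors through `ψ̂_{e_{j′}}`** — `Σ_{X″} ‖(E(F′⁺)S(F̃⁺)) X″ (x′,(point j′,σ,c))‖ ≤ (ρ′ + q)·‖(βL²)⁻¹‖·|SpaceTimeIdx|`
(`Σ_ω ‖F′_ω(k)‖ ≤ ρ′`, `‖P_j‖ ≤ 1`). [cite: BenfattoGiulianiMastropietro2006, §2.7 (2.71a)] -/
theorem colSum_overlap_pointAugment_natAdd_le (hF' : ∀ ω k, ‖F' ω k‖ ≤ 1) (hR : ∀ k, ‖1 - ∑ ω, F' ω k‖ ≤ 1) {ρ' : ℝ}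
    (hρ' : ∀ k : FreqMomentum L M, ∑ ω, ‖F' ω k‖ ≤ ρ') (x' : SpaceTimeIdx L M) (j' : Fin q) (σ c : Fin 2) :
    ∑ X'' : SpaceTimeIdx L M × SectorLeg (N' + q),
        ‖(sectorAnalysisMatrix L M β (pointAugment F' e) * sectorSubMatrix L M β (pointAugmentFat F Ft e)) X'' (x', ((Fin.natAdd N j', σ), c))‖ ≤
      (ρ' + q) * (‖((1 / (β * (L : ℝ) ^ 2) : ℝ) : ℂ)‖ * Fintype.card (SpaceTimeIdx L M)) := by
  have hfac : ∀ X'' : SpaceTimeIdx L M × SectorLeg (N' + q),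
      ‖(sectorAnalysisMatrix L M β (pointAugment F' e) * sectorSubMatrix L M β (pointAugmentFat F Ft e)) X'' (x', ((Fin.natAdd N j', σ), c))‖ ≤
        ‖sectorAnalysisMatrix L M β (pointAugment F' e) X'' ((e j', σ), c)‖ * ‖((1 / (β * (L : ℝ) ^ 2) : ℝ) : ℂ)‖ := by
    intro X''
    rw [sectorAnalysis_mul_sectorSub_apply_of_single_right β _ _ (pointAugmentFat_natAdd_eq_zero_of_ne F Ft e j') X'' x' σ c, norm_mul]
    refine mul_le_mul_of_nonneg_left ?_ (norm_nonneg _)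
    exact (norm_sectorSubMatrix_apply_le_mul β _ _ _).trans (mul_le_of_le_one_right (norm_nonneg _) (norm_pointAugmentFat_natAdd_le_one F Ft e j' _))
  refine (sum_le_sum fun X'' _ => hfac X'').trans ?_
  rw [← sum_mul, sum_norm_sectorAnalysisMatrix_eq]
  -- the augmented thin multiplicity at `e j′`: `Σ_ω ‖F′⁺_ω(e_{j′})‖ ≤ ρ′ + q`
  have hmult : ∑ ω : Fin (N' + q), ‖pointAugment F' e ω (e j')‖ ≤ ρ' + q := by
    rw [Fin.sum_univ_add]
    refine add_le_add ?_ ?_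
    · simp only [pointAugment_castAdd]; exact hρ' _
    · calc ∑ j : Fin q, ‖pointAugment F' e (Fin.natAdd N' j) (e j')‖ ≤ ∑ _j : Fin q, (1 : ℝ) :=
            sum_le_sum fun j _ => norm_pointAugment_le_one F' e hF' hR _ _
        _ = q := by rw [sum_const, card_univ, Fintype.card_fin, nsmul_eq_mul, mul_one]
  have hc : (0 : ℝ) ≤ Fintype.card (SpaceTimeIdx L M) := Nat.cast_nonneg _
  calc (Fintype.card (SpaceTimeIdx L M) : ℝ) * (∑ ω : Fin (N' + q), ‖pointAugment F' e ω (e j')‖) * ‖((1 / (β * (L : ℝ) ^ 2) : ℝ) : ℂ)‖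
      ≤ (Fintype.card (SpaceTimeIdx L M) : ℝ) * (ρ' + q) * ‖((1 / (β * (L : ℝ) ^ 2) : ℝ) : ℂ)‖ :=
        mul_le_mul_of_nonneg_right (mul_le_mul_of_nonneg_left hmult hc) (norm_nonneg _)
    _ = _ := by ring

end Blocks

/-! ## §3 Row and column sums of the augmented overlap matrix from the plain ones -/

section Sums

variable {L M N N' q : ℕ} [NeZero L] (β : ℝ) (F' : Fin N' → FreqMomentum L M → ℂ) (F Ft : Fin N → FreqMomentum L M → ℂ)
  (e : Fin q → FreqMomentum L M)

/-- **ROW SUMS TRANSFER (`hrow′`)**: if the plain overlap matrix `E(F′)·S(F̃)` has row sums `≤ cr` (`0 ≤ cr`), `‖F′‖ ≤ 1`, `‖1 − Σ_ω F′_ω‖ ≤ 1`, `‖F̃‖ ≤ 1` and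
at most `ρ₁` fat multipliers meet any momentum, then EVERY row sum of `E(pointAugment F′ e)·S(pointAugmentFat F F̃ e)` is
`≤ cr + (ρ₁ + q)·‖(βL²)⁻¹‖·|SpaceTimeIdx|` (old rows: `cr + q·ε⁻¹`; point rows: `(ρ₁ + q)·ε⁻¹`). [cite: BenfattoGiulianiMastropietro2006, §2.7 (2.71a)] -/
theorem rowSum_overlap_pointAugment_le (hF' : ∀ ω k, ‖F' ω k‖ ≤ 1) (hR : ∀ k, ‖1 - ∑ ω, F' ω k‖ ≤ 1) (hFt : ∀ ω k, ‖Ft ω k‖ ≤ 1)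
    {ρ₁ : ℕ} (hρ₁ : ∀ k : FreqMomentum L M, ((univ : Finset (Fin N)).filter fun ω => Ft ω k ≠ 0).card ≤ ρ₁) {cr : ℝ} (hcr0 : 0 ≤ cr)
    (hcr : ∀ Y'' : SpaceTimeIdx L M × SectorLeg N', ∑ Y' : SpaceTimeIdx L M × SectorLeg N,
      ‖(sectorAnalysisMatrix L M β F' * sectorSubMatrix L M β Ft) Y'' Y'‖ ≤ cr)
    (X'' : SpaceTimeIdx L M × SectorLeg (N' + q)) :
    ∑ X' : SpaceTimeIdx L M × SectorLeg (N + q),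
        ‖(sectorAnalysisMatrix L M β (pointAugment F' e) * sectorSubMatrix L M β (pointAugmentFat F Ft e)) X'' X'‖ ≤
      cr + ((ρ₁ + q : ℕ) : ℝ) * (‖((1 / (β * (L : ℝ) ^ 2) : ℝ) : ℂ)‖ * Fintype.card (SpaceTimeIdx L M)) := by
  classical
  have hεi : 0 ≤ ‖((1 / (β * (L : ℝ) ^ 2) : ℝ) : ℂ)‖ * (Fintype.card (SpaceTimeIdx L M) : ℝ) := by positivity
  by_cases hX : X'' ∈ (univ : Finset _).map (augLegEmb (N := N') (q := q))
  · -- an OLD thin row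
    obtain ⟨Y'', -, rfl⟩ := mem_map.1 hX
    rw [augLegEmb_apply, sum_sectorLegAug_split]
    have h1 : ∑ Y' : SpaceTimeIdx L M × SectorLeg N,
        ‖(sectorAnalysisMatrix L M β (pointAugment F' e) * sectorSubMatrix L M β (pointAugmentFat F Ft e)) (augLeg Y'') (augLeg Y')‖ ≤ cr := by
      simp only [overlap_pointAugment_augLeg_augLeg]
      exact hcr Y''
    have h2 : ∀ (x' : SpaceTimeIdx L M) (j' : Fin q), ∑ σ : Fin 2, ∑ c : Fin 2,
        ‖(sectorAnalysisMatrix L M β (pointAugment F' e) * sectorSubMatrix L M β (pointAugmentFat F Ft e)) (augLeg Y'')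
          (x', ((Fin.natAdd N j', σ), c))‖ ≤ ‖((1 / (β * (L : ℝ) ^ 2) : ℝ) : ℂ)‖ := by
      intro x' j'
      rw [sum_spin_charge_eq_single _ Y''.2.1.2 Y''.2.2 fun σ c h => by
        rw [sectorAnalysis_mul_sectorSub_apply_of_not β _ _ _ _ (by simpa only [augLeg] using h), norm_zero]]
      exact (norm_overlap_pointAugment_augLeg_natAdd_le β F' F Ft e Y'' x' j' _ _).trans
        (mul_le_of_le_one_right (norm_nonneg _) (hF' _ _))
    have h3 : ∑ x' : SpaceTimeIdx L M, ∑ j' : Fin q, ∑ σ : Fin 2, ∑ c : Fin 2,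
        ‖(sectorAnalysisMatrix L M β (pointAugment F' e) * sectorSubMatrix L M β (pointAugmentFat F Ft e)) (augLeg Y'')
          (x', ((Fin.natAdd N j', σ), c))‖ ≤ (q : ℝ) * (‖((1 / (β * (L : ℝ) ^ 2) : ℝ) : ℂ)‖ * Fintype.card (SpaceTimeIdx L M)) := by
      calc _ ≤ ∑ _x' : SpaceTimeIdx L M, ∑ _j' : Fin q, ‖((1 / (β * (L : ℝ) ^ 2) : ℝ) : ℂ)‖ :=
            sum_le_sum fun x' _ => sum_le_sum fun j' _ => h2 x' j'
        _ = (q : ℝ) * (‖((1 / (β * (L : ℝ) ^ 2) : ℝ) : ℂ)‖ * Fintype.card (SpaceTimeIdx L M)) := by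
            rw [sum_const, sum_const, card_univ, card_univ, Fintype.card_fin, nsmul_eq_mul, nsmul_eq_mul]
            ring
    have hq : (q : ℝ) * (‖((1 / (β * (L : ℝ) ^ 2) : ℝ) : ℂ)‖ * Fintype.card (SpaceTimeIdx L M)) ≤
        ((ρ₁ + q : ℕ) : ℝ) * (‖((1 / (β * (L : ℝ) ^ 2) : ℝ) : ℂ)‖ * Fintype.card (SpaceTimeIdx L M)) :=
      mul_le_mul_of_nonneg_right (by push_cast; linarith) hεi
    linarith
  · -- a POINT thin row
    obtain ⟨j, hj⟩ := exists_natAdd_of_not_mem_map X'' hX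
    obtain ⟨x'', ⟨⟨ω, σ⟩, c⟩⟩ := X''
    simp only at hj
    subst hj
    exact (rowSum_overlap_pointAugment_natAdd_le β F' F Ft e hF' hR hFt hρ₁ x'' j σ c).trans (le_add_of_nonneg_left hcr0)

/-- **COLUMN SUMS TRANSFER (`hcol′`)**: if the plain overlap matrix has column sums `≤ cc` (`0 ≤ cc`), `‖F′‖ ≤ 1`, `‖1 − Σ_ω F′_ω‖ ≤ 1`, `Σ_ω ‖F′_ω(k)‖ ≤ ρ′`
and `‖F̃‖ ≤ 1`, then EVERY column sum of `E(pointAugment F′ e)·S(pointAugmentFat F F̃ e)` is `≤ cc + (ρ′ + q)·‖(βL²)⁻¹‖·|SpaceTimeIdx|`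
(old columns: `cc + q·ε⁻¹`; point columns: `(ρ′ + q)·ε⁻¹`). [cite: BenfattoGiulianiMastropietro2006, §2.7 (2.71a)] -/
theorem colSum_overlap_pointAugment_le (hF' : ∀ ω k, ‖F' ω k‖ ≤ 1) (hR : ∀ k, ‖1 - ∑ ω, F' ω k‖ ≤ 1) {ρ' : ℝ} (hρ'0 : 0 ≤ ρ')
    (hρ' : ∀ k : FreqMomentum L M, ∑ ω, ‖F' ω k‖ ≤ ρ') (hFt : ∀ ω k, ‖Ft ω k‖ ≤ 1) {cc : ℝ} (hcc0 : 0 ≤ cc)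
    (hcc : ∀ Y' : SpaceTimeIdx L M × SectorLeg N, ∑ Y'' : SpaceTimeIdx L M × SectorLeg N',
      ‖(sectorAnalysisMatrix L M β F' * sectorSubMatrix L M β Ft) Y'' Y'‖ ≤ cc)
    (X' : SpaceTimeIdx L M × SectorLeg (N + q)) :
    ∑ X'' : SpaceTimeIdx L M × SectorLeg (N' + q),
        ‖(sectorAnalysisMatrix L M β (pointAugment F' e) * sectorSubMatrix L M β (pointAugmentFat F Ft e)) X'' X'‖ ≤
      cc + (ρ' + q) * (‖((1 / (β * (L : ℝ) ^ 2) : ℝ) : ℂ)‖ * Fintype.card (SpaceTimeIdx L M)) := by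
  classical
  have hεi : 0 ≤ ‖((1 / (β * (L : ℝ) ^ 2) : ℝ) : ℂ)‖ * (Fintype.card (SpaceTimeIdx L M) : ℝ) := by positivity
  by_cases hX : X' ∈ (univ : Finset _).map (augLegEmb (N := N) (q := q))
  · -- an OLD fat column
    obtain ⟨Y', -, rfl⟩ := mem_map.1 hX
    rw [augLegEmb_apply, sum_sectorLegAug_split]
    have h1 : ∑ Y'' : SpaceTimeIdx L M × SectorLeg N',
        ‖(sectorAnalysisMatrix L M β (pointAugment F' e) * sectorSubMatrix L M β (pointAugmentFat F Ft e)) (augLeg Y'') (augLeg Y')‖ ≤ cc := by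
      simp only [overlap_pointAugment_augLeg_augLeg]
      exact hcc Y'
    have h2 : ∀ (x'' : SpaceTimeIdx L M) (j : Fin q), ∑ σ : Fin 2, ∑ c : Fin 2,
        ‖(sectorAnalysisMatrix L M β (pointAugment F' e) * sectorSubMatrix L M β (pointAugmentFat F Ft e)) (x'', ((Fin.natAdd N' j, σ), c))
          (augLeg Y')‖ ≤ ‖((1 / (β * (L : ℝ) ^ 2) : ℝ) : ℂ)‖ := by
      intro x'' j
      rw [sum_spin_charge_eq_single _ Y'.2.1.2 Y'.2.2 fun σ c h => by
        rw [sectorAnalysis_mul_sectorSub_apply_of_not β _ _ _ _ (by simpa only [augLeg] using fun h' => h ⟨h'.1.symm, h'.2.symm⟩), norm_zero]]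
      rw [sectorAnalysis_mul_sectorSub_apply_of_single_left β _ _ (pointAugment_natAdd_eq_zero_of_ne F' e j) x'' _ _ (augLeg Y'), norm_mul]
      calc _ ≤ 1 * (‖((1 / (β * (L : ℝ) ^ 2) : ℝ) : ℂ)‖ * 1) := by
            refine mul_le_mul ?_ ?_ (norm_nonneg _) zero_le_one
            · rw [norm_sectorAnalysisMatrix_apply_diag]; exact norm_pointAugment_le_one F' e hF' hR _ _
            · refine (norm_sectorSubMatrix_apply_le_mul β _ _ _).trans (mul_le_mul_of_nonneg_left ?_ (norm_nonneg _))
              simp only [augLeg, pointAugmentFat_castAdd]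
              exact hFt _ _
        _ = _ := by ring
    have h3 : ∑ x'' : SpaceTimeIdx L M, ∑ j : Fin q, ∑ σ : Fin 2, ∑ c : Fin 2,
        ‖(sectorAnalysisMatrix L M β (pointAugment F' e) * sectorSubMatrix L M β (pointAugmentFat F Ft e)) (x'', ((Fin.natAdd N' j, σ), c))
          (augLeg Y')‖ ≤ (q : ℝ) * (‖((1 / (β * (L : ℝ) ^ 2) : ℝ) : ℂ)‖ * Fintype.card (SpaceTimeIdx L M)) := by
      calc _ ≤ ∑ _x'' : SpaceTimeIdx L M, ∑ _j : Fin q, ‖((1 / (β * (L : ℝ) ^ 2) : ℝ) : ℂ)‖ :=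
            sum_le_sum fun x'' _ => sum_le_sum fun j _ => h2 x'' j
        _ = (q : ℝ) * (‖((1 / (β * (L : ℝ) ^ 2) : ℝ) : ℂ)‖ * Fintype.card (SpaceTimeIdx L M)) := by
            rw [sum_const, sum_const, card_univ, card_univ, Fintype.card_fin, nsmul_eq_mul, nsmul_eq_mul]
            ring
    have hq : (q : ℝ) * (‖((1 / (β * (L : ℝ) ^ 2) : ℝ) : ℂ)‖ * Fintype.card (SpaceTimeIdx L M)) ≤
        (ρ' + q) * (‖((1 / (β * (L : ℝ) ^ 2) : ℝ) : ℂ)‖ * Fintype.card (SpaceTimeIdx L M)) :=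
      mul_le_mul_of_nonneg_right (by linarith) hεi
    linarith
  · -- a POINT fat column
    obtain ⟨j', hj⟩ := exists_natAdd_of_not_mem_map X' hX
    obtain ⟨x', ⟨⟨ω, σ⟩, c⟩⟩ := X'
    simp only at hj
    subst hj
    exact (colSum_overlap_pointAugment_natAdd_le β F' F Ft e hF' hR hρ' x' j' σ c).trans (le_add_of_nonneg_left hcc0)

end Sums

end Summit.HubbardSuperconductivity.HubbardSuperconductivity.Theorems.KLRegimeSplit

end
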